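import Mathlib
import Literature.Probability.Percolation.DiagonalStripWallWiring
import Literature.Probability.Percolation.DiagonalStripTransferInterlacingTwoRow
import Literature.Probability.Percolation.DiagonalStripHomogeneousPoint
import HarnessLib

/-!
# The transfer matrix at `z_1 = 0` and the vanishing of wall-connected components

Topic `Literature/Probability/Percolation`. For IP12's inhomogeneous two-layer transfer matrix
`t(w; z⃗)` (Ikhlef–Ponsaing, J. Stat. Phys. 149 (2012), arXiv:1202.5476, §3.1) we split the
polynomial-weight kernel `N = ipTwoLayerWR num₀ (den₀-num₀) num₁ (den₁-num₁)` at the two edges of top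
level `1` (`DiagonalStripWallWiring`): since the three configurations with an open level-`1` edge
have the same lumped outcome, `N = (a₀a₁ + a₀b₁ + b₀a₁) N^{wired} + b₀b₁ N^{cc}`
(**`ipTwoLayerWR_split`**, via **`ipTwoLayerWR_eq_sum_twoStep`**). At `z_1 = 0` (the substitution
`X_1 ↦ 0`) the level-`1` weights satisfy `a₀a₁ + a₀b₁ + b₀a₁ = 0` (`(1-A₀)(1-A₁) = 1` with
`A₀ = -q`, `A₁ = -q²`), so the polynomial fixed-point equation `Σ_Q P_Q N_{QQ'} = Δ P_{Q'}` of the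
primitive ground state becomes `Σ_Q P_Q(z_1:=0) N^{cc}_{QQ'} = Δ' P_{Q'}(z_1:=0)`
(**`IsGroundState.sum_substHom_mul_gsCcKernel`**). The closed–closed kernel does not lead from
wall-disconnected to wall-connected patterns, and on the wall-connected block `N^{cc} - Δ'` is
nonsingular — at the percolation point it is `#configurations - 4^{2n}` with row sums `< 4^{2n}`
(**`det_natMatrix_sub_ne_zero`**, a strictly substochastic count matrix has no eigenvalue at the
bound). Hence **`IsGroundState.substHom_one_zero_eq_zero`**: `P_Q(z_1 := 0) = 0` for every
wall-connected `Q`, and the `vanish` clause of `GroundStateBounds` (**`IsGroundState.vanish`**).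

## References

* Y. Ikhlef, A. K. Ponsaing, *Finite-size left-passage probability in percolation*, J. Stat. Phys.
  149 (2012) 10–36, arXiv:1202.5476, §3.1, §4.1. [IkhlefPonsaing2012]
-/

namespace Literature.Probability.Percolation

open Finset Relation Literature.Probability.LatticeModels

variable {m : ℕ}
/-! ## (Y2) The two-layer kernel split at the level-`1` edges -/

section KernelSplit

variable {R : Type*} [CommRing R]

/-- The weight of an edge set in a layer with open/closed weights `a`, `b`. [folklore] -/
noncomputable def edgeWt (a b : Sym2 (Site 2) → R) (L U : Finset (Sym2 (Site 2))) : R :=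
  (∏ e ∈ U, a e) * ∏ e ∈ L \ U, b e

/-- Commuting a pair of sums past another pair. [folklore] -/
theorem sum_sum_sum_sum_comm {α β γ δ : Type*} (s₁ : Finset α) (s₂ : Finset β) (t₁ : Finset γ) (t₂ : Finset δ)
    (f : α → β → γ → δ → R) :
    ∑ a ∈ s₁, ∑ b ∈ s₂, ∑ c ∈ t₁, ∑ d ∈ t₂, f a b c d = ∑ c ∈ t₁, ∑ d ∈ t₂, ∑ a ∈ s₁, ∑ b ∈ s₂, f a b c d := by
  calc ∑ a ∈ s₁, ∑ b ∈ s₂, ∑ c ∈ t₁, ∑ d ∈ t₂, f a b c d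
      = ∑ a ∈ s₁, ∑ c ∈ t₁, ∑ b ∈ s₂, ∑ d ∈ t₂, f a b c d := Finset.sum_congr rfl fun _ _ => Finset.sum_comm
    _ = ∑ c ∈ t₁, ∑ a ∈ s₁, ∑ b ∈ s₂, ∑ d ∈ t₂, f a b c d := Finset.sum_comm
    _ = ∑ c ∈ t₁, ∑ a ∈ s₁, ∑ d ∈ t₂, ∑ b ∈ s₂, f a b c d :=
        Finset.sum_congr rfl fun _ _ => Finset.sum_congr rfl fun _ _ => Finset.sum_comm
    _ = ∑ c ∈ t₁, ∑ d ∈ t₂, ∑ a ∈ s₁, ∑ b ∈ s₂, f a b c d := Finset.sum_congr rfl fun _ _ => Finset.sum_comm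

/-- **The two-layer kernel as a sum over pairs of edge sets.** [cite: IkhlefPonsaing2012, §3.1] -/
theorem ipTwoLayerWR_eq_sum_twoStep (a₀ b₀ a₁ b₁ : Sym2 (Site 2) → R) (Q Q' : ColPattern m) :
    ipTwoLayerWR m a₀ b₀ a₁ b₁ Q Q' = ∑ U₀ ∈ (latticeLayer m 0).powerset, ∑ U₁ ∈ (latticeLayer m 1).powerset,
      if twoStep Q U₀ U₁ = Q' then edgeWt a₀ b₀ (latticeLayer m 0) U₀ * edgeWt a₁ b₁ (latticeLayer m 1) U₁ else 0 := by
  classical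
  have h3 : ∀ U₀ U₁, (∑ P₁ : ColPattern m, ∑ P₂ ∈ Finset.univ.filter (fun P₂ : ColPattern m => lump P₂ = Q'),
      (if colUpdate m 0 Q (edgeFn m 0 U₀) = P₁ then edgeWt a₀ b₀ (latticeLayer m 0) U₀ else 0) *
        (if colUpdate m 1 P₁ (edgeFn m 1 U₁) = P₂ then edgeWt a₁ b₁ (latticeLayer m 1) U₁ else 0)) =
      if twoStep Q U₀ U₁ = Q' then edgeWt a₀ b₀ (latticeLayer m 0) U₀ * edgeWt a₁ b₁ (latticeLayer m 1) U₁ else 0 := by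
    intro U₀ U₁
    simp_rw [← Finset.mul_sum]
    simp_rw [ite_mul, zero_mul]
    rw [Finset.sum_ite_eq, if_pos (Finset.mem_univ _), Finset.sum_ite_eq]
    simp only [Finset.mem_filter, Finset.mem_univ, true_and, twoStep]
    split_ifs <;> simp
  unfold ipTwoLayerWR ipTransferWR
  simp_rw [Finset.sum_mul_sum]
  rw [sum_sum_sum_sum_comm]
  exact Finset.sum_congr rfl fun U₀ _ => Finset.sum_congr rfl fun U₁ _ => h3 U₀ U₁

/-- Splitting a sum over subsets at one element. [folklore] -/
theorem sum_powerset_split {α : Type*} [DecidableEq α] {L : Finset α} {e : α} (he : e ∈ L) (f : Finset α → R) :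
    ∑ U ∈ L.powerset, f U = ∑ V ∈ (L.erase e).powerset, (f V + f (insert e V)) := by
  conv_lhs => rw [← Finset.insert_erase he]
  rw [Finset.sum_powerset_insert (Finset.notMem_erase e L), Finset.sum_add_distrib]

variable (a b : Sym2 (Site 2) → R)

/-- The weight of an edge set containing the distinguished edge. [folklore] -/
theorem edgeWt_insert {L V : Finset (Sym2 (Site 2))} {e : Sym2 (Site 2)} (hV : V ⊆ L.erase e) :
    edgeWt a b L (insert e V) = a e * edgeWt a b (L.erase e) V := by
  classical
  have heV : e ∉ V := fun h => Finset.notMem_erase e L (hV h)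
  unfold edgeWt
  rw [Finset.prod_insert heV]
  have : L \ insert e V = L.erase e \ V := by
    ext x; simp only [Finset.mem_sdiff, Finset.mem_insert, Finset.mem_erase, not_or]; tauto
  rw [this]; ring

/-- The weight of an edge set missing the distinguished edge. [folklore] -/
theorem edgeWt_of_subset_erase {L V : Finset (Sym2 (Site 2))} {e : Sym2 (Site 2)} (he : e ∈ L) (hV : V ⊆ L.erase e) :
    edgeWt a b L V = b e * edgeWt a b (L.erase e) V := by
  classical
  have heV : e ∉ V := fun h => Finset.notMem_erase e L (hV h)
  unfold edgeWt
  have : L \ V = insert e (L.erase e \ V) := by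
    ext x
    simp only [Finset.mem_sdiff, Finset.mem_insert, Finset.mem_erase]
    constructor
    · rintro ⟨hx, hxV⟩
      by_cases hxe : x = e
      · exact Or.inl hxe
      · exact Or.inr ⟨⟨hxe, hx⟩, hxV⟩
    · rintro (rfl | ⟨⟨-, hx⟩, hxV⟩)
      · exact ⟨he, heV⟩
      · exact ⟨hx, hxV⟩
  rw [this, Finset.prod_insert (by simp)]
  ring

variable (a₀ b₀ a₁ b₁ : Sym2 (Site 2) → R)

/-- The **closed–closed kernel**: both level-`1` edges closed, weights of the other edges.
[cite: IkhlefPonsaing2012, §3.1] -/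
noncomputable def ccKernel (Q Q' : ColPattern m) : R :=
  ∑ V₀ ∈ ((latticeLayer m 0).erase levelOneEdge₀).powerset, ∑ V₁ ∈ ((latticeLayer m 1).erase levelOneEdge₁).powerset,
    if twoStep Q V₀ V₁ = Q' then
      edgeWt a₀ b₀ ((latticeLayer m 0).erase levelOneEdge₀) V₀ * edgeWt a₁ b₁ ((latticeLayer m 1).erase levelOneEdge₁) V₁
    else 0

/-- The **wired kernel**: the level-`1` edge of layer `0` open, that of layer `1` closed.
[cite: IkhlefPonsaing2012, §3.1] -/
noncomputable def wiredKernel (Q Q' : ColPattern m) : R :=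
  ∑ V₀ ∈ ((latticeLayer m 0).erase levelOneEdge₀).powerset, ∑ V₁ ∈ ((latticeLayer m 1).erase levelOneEdge₁).powerset,
    if twoStep Q (insert levelOneEdge₀ V₀) V₁ = Q' then
      edgeWt a₀ b₀ ((latticeLayer m 0).erase levelOneEdge₀) V₀ * edgeWt a₁ b₁ ((latticeLayer m 1).erase levelOneEdge₁) V₁
    else 0

variable {Q : ColPattern m}

/-- **The split of the two-layer kernel at the level-`1` edges**: for a valid lumped input pattern,
`N = (a₀a₁ + a₀b₁ + b₀a₁)(e) · N^{wired} + b₀b₁(e) · N^{cc}` (the three configurations with an open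
level-`1` edge have the same lumped outcome). [cite: IkhlefPonsaing2012, §3.1] -/
theorem ipTwoLayerWR_split (hQ : IsValid 0 Q) (hl : lump Q = Q) (Q' : ColPattern m) :
    ipTwoLayerWR m a₀ b₀ a₁ b₁ Q Q' =
      (a₀ levelOneEdge₀ * a₁ levelOneEdge₁ + a₀ levelOneEdge₀ * b₁ levelOneEdge₁ + b₀ levelOneEdge₀ * a₁ levelOneEdge₁) *
          wiredKernel a₀ b₀ a₁ b₁ Q Q' +
        b₀ levelOneEdge₀ * b₁ levelOneEdge₁ * ccKernel a₀ b₀ a₁ b₁ Q Q' := by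
  classical
  rw [ipTwoLayerWR_eq_sum_twoStep, sum_powerset_split (levelOneEdge₀_mem (m := m))]
  simp_rw [sum_powerset_split (levelOneEdge₁_mem (m := m))]
  unfold wiredKernel ccKernel
  rw [Finset.mul_sum, Finset.mul_sum, ← Finset.sum_add_distrib]
  refine Finset.sum_congr rfl fun V₀ hV₀ => ?_
  rw [Finset.mul_sum, Finset.mul_sum, ← Finset.sum_add_distrib, ← Finset.sum_add_distrib]
  refine Finset.sum_congr rfl fun V₁ hV₁ => ?_
  rw [Finset.mem_powerset] at hV₀ hV₁
  have hiso : ∀ i, edgeFn m 1 V₁ i 0 = false := edgeFn_one_bottom hV₁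
  rw [twoStep_insert₀_insert₁ hQ hl V₀ hiso, ← twoStep_insert₀_eq_insert₁ hQ hl V₀ hiso,
    edgeWt_insert a₀ b₀ hV₀, edgeWt_insert a₁ b₁ hV₁, edgeWt_of_subset_erase a₀ b₀ levelOneEdge₀_mem hV₀,
    edgeWt_of_subset_erase a₁ b₁ levelOneEdge₁_mem hV₁]
  split_ifs <;> ring

end KernelSplit

/-! ## (Y2') The ground state's fixed-point equation at `z_1 = 0` -/

section AtZero

open MvPolynomial

variable {n : ℕ} {q : ℂ}

/-- The top level of `levelOneEdge₀` is `1`. [folklore] -/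
theorem edgeTopLevel_levelOneEdge₀ : (edgeTopLevel levelOneEdge₀).toNat = 1 := by
  rw [levelOneEdge₀, edgeTopLevel_mk_colSite]; decide

/-- The top level of `levelOneEdge₁` is `1`. [folklore] -/
theorem edgeTopLevel_levelOneEdge₁ : (edgeTopLevel levelOneEdge₁).toNat = 1 := by
  rw [levelOneEdge₁, edgeTopLevel_mk_colSite]; decide

/-- The other edges of layer `0` have top level `≥ 2`. [folklore] -/
theorem two_le_edgeTopLevel_of_mem_erase₀ {e : Sym2 (Site 2)} (he : e ∈ (latticeLayer n 0).erase levelOneEdge₀) :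
    2 ≤ (edgeTopLevel e).toNat := by
  rw [Finset.mem_erase, latticeLayer_eq_image, Finset.mem_image] at he
  obtain ⟨hne, p, hp, rfl⟩ := he
  rw [edgeTopLevel_mk_colSite]
  simp only [latticeIdx, Finset.mem_filter, Finset.mem_univ, true_and] at hp
  by_contra hlt
  rw [not_le] at hlt
  have h1 : (p.1 : ℕ) = 0 := by
    have : ((2 * (p.1 : ℕ) + 0 % 2 : ℤ)) ≤ max (2 * (p.1 : ℕ) + 0 % 2 : ℤ) (2 * (p.2 : ℕ) + (0 + 1) % 2) := le_max_left _ _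
    omega
  have h2 : (p.2 : ℕ) = 0 := by
    have : ((2 * (p.2 : ℕ) + (0 + 1) % 2 : ℤ)) ≤ max (2 * (p.1 : ℕ) + 0 % 2 : ℤ) (2 * (p.2 : ℕ) + (0 + 1) % 2) := le_max_right _ _
    omega
  refine hne ?_
  rw [levelOneEdge₀]
  congr 1 <;> simp [h1, h2]

/-- The other edges of layer `1` have top level `≥ 2`. [folklore] -/
theorem two_le_edgeTopLevel_of_mem_erase₁ {e : Sym2 (Site 2)} (he : e ∈ (latticeLayer n 1).erase levelOneEdge₁) :
    2 ≤ (edgeTopLevel e).toNat := by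
  rw [Finset.mem_erase, latticeLayer_eq_image, Finset.mem_image] at he
  obtain ⟨hne, p, hp, rfl⟩ := he
  rw [edgeTopLevel_mk_colSite]
  simp only [latticeIdx, Finset.mem_filter, Finset.mem_univ, true_and] at hp
  by_contra hlt
  rw [not_le] at hlt
  have h1 : (p.1 : ℕ) = 0 := by
    have : ((2 * (p.1 : ℕ) + 1 % 2 : ℤ)) ≤ max (2 * (p.1 : ℕ) + 1 % 2 : ℤ) (2 * (p.2 : ℕ) + (1 + 1) % 2) := le_max_left _ _
    omega
  have h2 : (p.2 : ℕ) = 0 := by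
    have : ((2 * (p.2 : ℕ) + (1 + 1) % 2 : ℤ)) ≤ max (2 * (p.1 : ℕ) + 1 % 2 : ℤ) (2 * (p.2 : ℕ) + (1 + 1) % 2) := le_max_right _ _
    omega
  refine hne ?_
  rw [levelOneEdge₁]
  congr 1 <;> simp [h1, h2]

/-! ### Substituting `X_1 ↦ 0` -/

/-- Ring homomorphisms act on edge weights. [folklore] -/
theorem map_edgeWt {R R' : Type*} [CommRing R] [CommRing R'] (φ : R →+* R') (a b : Sym2 (Site 2) → R)
    (L V : Finset (Sym2 (Site 2))) : φ (edgeWt a b L V) = edgeWt (φ ∘ a) (φ ∘ b) L V := by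
  unfold edgeWt; simp [map_mul, map_prod]

/-- Edge weights only see the weights of the layer's edges. [folklore] -/
theorem edgeWt_congr {R : Type*} [CommRing R] {a a' b b' : Sym2 (Site 2) → R} {L V : Finset (Sym2 (Site 2))}
    (hV : V ⊆ L) (ha : ∀ e ∈ L, a e = a' e) (hb : ∀ e ∈ L, b e = b' e) : edgeWt a b L V = edgeWt a' b' L V := by
  unfold edgeWt
  rw [Finset.prod_congr rfl fun e he => ha e (hV he), Finset.prod_congr rfl fun e he => hb e (Finset.sdiff_subset he)]

/-- Ring homomorphisms act on the closed–closed kernel. [folklore] -/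
theorem map_ccKernel {R R' : Type*} [CommRing R] [CommRing R'] (φ : R →+* R') (a₀ b₀ a₁ b₁ : Sym2 (Site 2) → R)
    (Q Q' : ColPattern n) :
    φ (ccKernel a₀ b₀ a₁ b₁ Q Q') = ccKernel (φ ∘ a₀) (φ ∘ b₀) (φ ∘ a₁) (φ ∘ b₁) Q Q' := by
  unfold ccKernel
  simp only [map_sum]
  refine Finset.sum_congr rfl fun V₀ _ => Finset.sum_congr rfl fun V₁ _ => ?_
  split_ifs
  · rw [map_mul, map_edgeWt, map_edgeWt]
  · exact map_zero φ

/-- The closed–closed kernel only sees the weights of the non-level-`1` edges. [folklore] -/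
theorem ccKernel_congr {R : Type*} [CommRing R] {a₀ a₀' b₀ b₀' a₁ a₁' b₁ b₁' : Sym2 (Site 2) → R}
    (h₀ : ∀ e ∈ (latticeLayer n 0).erase levelOneEdge₀, a₀ e = a₀' e ∧ b₀ e = b₀' e)
    (h₁ : ∀ e ∈ (latticeLayer n 1).erase levelOneEdge₁, a₁ e = a₁' e ∧ b₁ e = b₁' e) (Q Q' : ColPattern n) :
    ccKernel a₀ b₀ a₁ b₁ Q Q' = ccKernel a₀' b₀' a₁' b₁' Q Q' := by
  unfold ccKernel
  refine Finset.sum_congr rfl fun V₀ hV₀ => Finset.sum_congr rfl fun V₁ hV₁ => ?_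
  rw [Finset.mem_powerset] at hV₀ hV₁
  rw [edgeWt_congr hV₀ (fun e he => (h₀ e he).1) (fun e he => (h₀ e he).2),
    edgeWt_congr hV₁ (fun e he => (h₁ e he).1) (fun e he => (h₁ e he).2)]

variable (q)

/-- The closed weights `b = den - num`. [cite: IkhlefPonsaing2012, Def. 3.1, 3.3] -/
noncomputable def ipClosedPoly (r : Fin 2) (e : Sym2 (Site 2)) : MvPolynomial ℕ ℂ := ipDenPoly q r e - ipNumPoly q r e

/-- **The ground state's closed–closed kernel** (polynomial weights, level-`1` edges closed).
[cite: IkhlefPonsaing2012, §3.1, §4.1] -/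
noncomputable def gsCcKernel (n : ℕ) (Q Q' : ColPattern n) : MvPolynomial ℕ ℂ :=
  ccKernel (ipNumPoly q 0) (ipClosedPoly q 0) (ipNumPoly q 1) (ipClosedPoly q 1) Q Q'

/-- The common denominator of the non-level-`1` edges. [folklore] -/
noncomputable def gsCcDelta (n : ℕ) : MvPolynomial ℕ ℂ :=
  (∏ e ∈ (latticeLayer n 0).erase levelOneEdge₀, ipDenPoly q 0 e) * ∏ e ∈ (latticeLayer n 1).erase levelOneEdge₁, ipDenPoly q 1 e

variable {q}

/-- `X_1 ↦ 0` fixes the numerators of edges of top level `≥ 2`. [folklore] -/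
theorem substHom_ipNumPoly_of_two_le (r : Fin 2) {e : Sym2 (Site 2)} (hk : 2 ≤ (edgeTopLevel e).toNat) :
    substHom 1 0 (ipNumPoly q r e) = ipNumPoly q r e := by
  have h1 : (edgeTopLevel e).toNat ≠ 1 := by omega
  unfold ipNumPoly
  split_ifs <;> simp [map_sub, map_mul, substHom_X_of_ne _ h1, substHom_X_of_ne _ (show (0 : ℕ) ≠ 1 by decide)]

/-- `X_1 ↦ 0` fixes the denominators of edges of top level `≥ 2`. [folklore] -/
theorem substHom_ipDenPoly_of_two_le (r : Fin 2) {e : Sym2 (Site 2)} (hk : 2 ≤ (edgeTopLevel e).toNat) :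
    substHom 1 0 (ipDenPoly q r e) = ipDenPoly q r e := by
  have h1 : (edgeTopLevel e).toNat ≠ 1 := by omega
  unfold ipDenPoly
  split_ifs <;> simp [map_sub, map_mul, substHom_X_of_ne _ h1, substHom_X_of_ne _ (show (0 : ℕ) ≠ 1 by decide)]

/-- `X_1 ↦ 0` fixes the ground state's closed–closed kernel. [folklore] -/
theorem substHom_gsCcKernel (Q Q' : ColPattern n) : substHom 1 0 (gsCcKernel q n Q Q') = gsCcKernel q n Q Q' := by
  unfold gsCcKernel
  rw [show (substHom 1 (0 : MvPolynomial ℕ ℂ)) (ccKernel (ipNumPoly q 0) (ipClosedPoly q 0) (ipNumPoly q 1) (ipClosedPoly q 1) Q Q') =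
    (substHom 1 (0 : MvPolynomial ℕ ℂ)).toRingHom (ccKernel (ipNumPoly q 0) (ipClosedPoly q 0) (ipNumPoly q 1) (ipClosedPoly q 1) Q Q')
    from rfl, map_ccKernel]
  refine ccKernel_congr (fun e he => ?_) (fun e he => ?_) Q Q'
  · have hk := two_le_edgeTopLevel_of_mem_erase₀ he
    simp only [Function.comp, AlgHom.toRingHom_eq_coe, RingHom.coe_coe, ipClosedPoly, map_sub,
      substHom_ipNumPoly_of_two_le _ hk, substHom_ipDenPoly_of_two_le _ hk, and_self]
  · have hk := two_le_edgeTopLevel_of_mem_erase₁ he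
    simp only [Function.comp, AlgHom.toRingHom_eq_coe, RingHom.coe_coe, ipClosedPoly, map_sub,
      substHom_ipNumPoly_of_two_le _ hk, substHom_ipDenPoly_of_two_le _ hk, and_self]

/-- `X_1 ↦ 0` fixes the reduced denominator. [folklore] -/
theorem substHom_gsCcDelta : substHom 1 0 (gsCcDelta q n) = gsCcDelta q n := by
  unfold gsCcDelta
  rw [map_mul, map_prod, map_prod]
  rw [Finset.prod_congr rfl fun e he => substHom_ipDenPoly_of_two_le 0 (two_le_edgeTopLevel_of_mem_erase₀ he),
    Finset.prod_congr rfl fun e he => substHom_ipDenPoly_of_two_le 1 (two_le_edgeTopLevel_of_mem_erase₁ he)]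

/-- The level-`1` weights at `X_1 = 0`, row `0`. [cite: IkhlefPonsaing2012, Def. 3.1] -/
theorem substHom_level_one₀ :
    substHom 1 0 (ipNumPoly q 0 levelOneEdge₀) = -X 0 ^ 2 ∧ substHom 1 0 (ipDenPoly q 0 levelOneEdge₀) = C q ^ 2 * X 0 ^ 2 := by
  unfold ipNumPoly ipDenPoly
  rw [edgeTopLevel_levelOneEdge₀]
  simp [map_sub, map_mul, substHom_X_of_ne _ (show (0 : ℕ) ≠ 1 by decide)]

/-- The level-`1` weights at `X_1 = 0`, row `1`. [cite: IkhlefPonsaing2012, Def. 3.3] -/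
theorem substHom_level_one₁ :
    substHom 1 0 (ipNumPoly q 1 levelOneEdge₁) = C q ^ 2 ∧ substHom 1 0 (ipDenPoly q 1 levelOneEdge₁) = -1 := by
  unfold ipNumPoly ipDenPoly
  rw [edgeTopLevel_levelOneEdge₁]
  simp [map_sub, map_mul, substHom_X_of_ne _ (show (0 : ℕ) ≠ 1 by decide)]

/-- `Δ = den₀(e₀) · den₁(e₁) · Δ'`. [folklore] -/
theorem ipDeltaPoly_eq_mul_gsCcDelta :
    ipDeltaPoly n q = ipDenPoly q 0 levelOneEdge₀ * ipDenPoly q 1 levelOneEdge₁ * gsCcDelta q n := by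
  unfold ipDeltaPoly gsCcDelta
  rw [← Finset.mul_prod_erase _ _ (levelOneEdge₀_mem (m := n)), ← Finset.mul_prod_erase _ _ (levelOneEdge₁_mem (m := n))]
  ring

namespace IsGroundState

variable {P : ColPattern n → MvPolynomial ℕ ℂ} {a : ℤ}

/-- The polynomial fixed-point equation `Σ_Q P_Q N_{QQ'} = Δ P_{Q'}`. [cite: IkhlefPonsaing2012, §3.1] -/
theorem sum_mul_ipTwoLayerWR (hq : q ^ 2 + q + 1 = 0) (h : IsGroundState n q P a) (Q' : ColPattern n) :
    ∑ Q, P Q * ipTwoLayerWR n (ipNumPoly q 0) (ipClosedPoly q 0) (ipNumPoly q 1) (ipClosedPoly q 1) Q Q' =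
      ipDeltaPoly n q * P Q' := by
  have h0 := h.sum_mul_ipNMat hq Q'
  simp only [ipNMat, Matrix.sub_apply, Matrix.of_apply, Matrix.smul_apply, Matrix.one_apply, smul_eq_mul, mul_ite,
    mul_one, mul_zero, mul_sub, Finset.sum_sub_distrib, Finset.sum_ite_eq', Finset.mem_univ, if_true] at h0
  rw [sub_eq_zero] at h0
  rw [show ipClosedPoly q 0 = fun e => ipDenPoly q 0 e - ipNumPoly q 0 e from rfl,
    show ipClosedPoly q 1 = fun e => ipDenPoly q 1 e - ipNumPoly q 1 e from rfl, h0, mul_comm]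

/-- **The fixed-point equation at `z_1 = 0`**: `Σ_Q P_Q(z_1:=0) N^{cc}_{QQ'} = Δ' P_{Q'}(z_1:=0)` — at
`z_1 = 0` the three level-`1` configurations with an open edge cancel (`(1-a₀)(1-a₁) = 1`), leaving the
closed–closed kernel. [cite: IkhlefPonsaing2012, §3.1, §4.1] -/
theorem sum_substHom_mul_gsCcKernel (hq : q ^ 2 + q + 1 = 0) (h : IsGroundState n q P a) (Q' : ColPattern n) :
    ∑ Q, substHom 1 0 (P Q) * gsCcKernel q n Q Q' = gsCcDelta q n * substHom 1 0 (P Q') := by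
  have hfix := h.sum_mul_ipTwoLayerWR hq Q'
  -- split the kernel on the support
  have hsplit : ∀ Q, P Q * ipTwoLayerWR n (ipNumPoly q 0) (ipClosedPoly q 0) (ipNumPoly q 1) (ipClosedPoly q 1) Q Q' =
      P Q * ((ipNumPoly q 0 levelOneEdge₀ * ipNumPoly q 1 levelOneEdge₁ + ipNumPoly q 0 levelOneEdge₀ * ipClosedPoly q 1 levelOneEdge₁ +
          ipClosedPoly q 0 levelOneEdge₀ * ipNumPoly q 1 levelOneEdge₁) *
          wiredKernel (ipNumPoly q 0) (ipClosedPoly q 0) (ipNumPoly q 1) (ipClosedPoly q 1) Q Q' +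
        ipClosedPoly q 0 levelOneEdge₀ * ipClosedPoly q 1 levelOneEdge₁ * gsCcKernel q n Q Q') := by
    intro Q
    by_cases hPQ : P Q = 0
    · rw [hPQ, zero_mul, zero_mul]
    · obtain ⟨hv, -, hl⟩ := h.supp hq Q (fun h0 => hPQ (toRF_injective (by rw [h0, map_zero])))
      rw [ipTwoLayerWR_split _ _ _ _ hv hl, gsCcKernel]
  rw [Finset.sum_congr rfl fun Q _ => hsplit Q] at hfix
  set coef := ipNumPoly q 0 levelOneEdge₀ * ipNumPoly q 1 levelOneEdge₁ + ipNumPoly q 0 levelOneEdge₀ * ipClosedPoly q 1 levelOneEdge₁ +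
          ipClosedPoly q 0 levelOneEdge₀ * ipNumPoly q 1 levelOneEdge₁ with hcoef_def
  set bb := ipClosedPoly q 0 levelOneEdge₀ * ipClosedPoly q 1 levelOneEdge₁ with hbb_def
  clear_value coef bb
  have hfix' : coef * (∑ Q, P Q * wiredKernel (ipNumPoly q 0) (ipClosedPoly q 0) (ipNumPoly q 1) (ipClosedPoly q 1) Q Q') +
      bb * (∑ Q, P Q * gsCcKernel q n Q Q') = ipDeltaPoly n q * P Q' := by
    rw [← hfix, Finset.mul_sum, Finset.mul_sum, ← Finset.sum_add_distrib]
    exact Finset.sum_congr rfl fun Q _ => by ring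
  obtain ⟨hn₀, hd₀⟩ := substHom_level_one₀ (q := q)
  obtain ⟨hn₁, hd₁⟩ := substHom_level_one₁ (q := q)
  have hb₀ : substHom 1 0 (ipClosedPoly q 0 levelOneEdge₀) = (C q ^ 2 + 1) * X 0 ^ 2 := by
    rw [ipClosedPoly, map_sub, hn₀, hd₀]; ring
  have hb₁ : substHom 1 0 (ipClosedPoly q 1 levelOneEdge₁) = -1 - C q ^ 2 := by
    rw [ipClosedPoly, map_sub, hn₁, hd₁]
  have hC : (C q : MvPolynomial ℕ ℂ) ^ 2 + C q + 1 = 0 := by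
    rw [← C_pow, ← C_1, ← C_add, ← C_add, hq, C_0]
  have hcoef : substHom 1 0 coef = 0 := by
    rw [hcoef_def, map_add, map_add, map_mul, map_mul, map_mul, hn₀, hn₁, hb₀, hb₁]
    linear_combination (X 0 ^ 2 * (C q ^ 2 - C q + 1)) * hC
  have hbb : substHom 1 0 bb = -(C q ^ 2 * X 0 ^ 2) := by
    rw [hbb_def, map_mul, hb₀, hb₁]
    linear_combination (-(X 0 ^ 2) * (C q ^ 2 - C q + 1)) * hC
  have hΔ : substHom 1 0 (ipDeltaPoly n q) = -(C q ^ 2 * X 0 ^ 2) * gsCcDelta q n := by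
    rw [ipDeltaPoly_eq_mul_gsCcDelta, map_mul, map_mul, hd₀, hd₁, substHom_gsCcDelta]; ring
  have hφ := congrArg (substHom 1 (0 : MvPolynomial ℕ ℂ)) hfix'
  rw [map_add, map_mul, hcoef, zero_mul, zero_add, map_mul, hbb, map_mul, hΔ, map_sum] at hφ
  simp_rw [map_mul, substHom_gsCcKernel] at hφ
  -- cancel the common nonzero factor
  have hκ : (-(C q ^ 2 * X 0 ^ 2) : MvPolynomial ℕ ℂ) ≠ 0 := by
    refine neg_ne_zero.2 (mul_ne_zero (pow_ne_zero _ ?_) (pow_ne_zero _ (X_ne_zero 0)))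
    exact (map_ne_zero_iff C (C_injective ℕ ℂ)).2 (q_ne_zero_of_quad hq)
  have : -(C q ^ 2 * X 0 ^ 2) * (∑ Q, substHom 1 0 (P Q) * gsCcKernel q n Q Q' - gsCcDelta q n * substHom 1 0 (P Q')) = 0 := by
    rw [mul_sub, hφ]; ring
  exact sub_eq_zero.1 ((mul_eq_zero.1 this).resolve_left hκ)

end IsGroundState

end AtZero

/-! ## (Y3) Vanishing at `z_1 = 0` on wall-connected patterns -/

section WallVanishing

open MvPolynomial

variable {n : ℕ} {q : ℂ}

/-- The number of closed–closed two-layer configurations leading from `Q` to `Q'`. [folklore] -/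
noncomputable def ccCount (n : ℕ) (Q Q' : ColPattern n) : ℕ :=
  ∑ V₀ ∈ ((latticeLayer n 0).erase levelOneEdge₀).powerset, ∑ V₁ ∈ ((latticeLayer n 1).erase levelOneEdge₁).powerset,
    if twoStep Q V₀ V₁ = Q' then 1 else 0

/-- With all edges closed the two-layer update is wall-disconnected (whatever the input). [folklore] -/
theorem not_wallConn_twoStep_empty (Q : ColPattern n) : ¬ WallConn (twoStep Q ∅ ∅) := by
  rintro ⟨j, hj, hflag⟩
  unfold twoStep at hflag
  rw [lump_snd, colUpdate_snd_iff] at hflag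
  obtain ⟨z, hz, hw⟩ := hflag
  have hE : edgeFn n 1 (∅ : Finset (Sym2 (Site 2))) = fun _ _ => false := by
    funext i j'; simp [edgeFn]
  rw [hE] at hz
  have := eqvGen_updRel_false_inr hz
  subst this
  simp only [updWall] at hw
  exact hj (Fin.ext hw.2)

/-- The erased layers have `2n` edges. [folklore] -/
theorem card_erase_levelOneEdge₀ : ((latticeLayer n 0).erase levelOneEdge₀).card = 2 * n := by
  rw [Finset.card_erase_of_mem levelOneEdge₀_mem, card_latticeLayer]; rfl

/-- The erased layers have `2n` edges. [folklore] -/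
theorem card_erase_levelOneEdge₁ : ((latticeLayer n 1).erase levelOneEdge₁).card = 2 * n := by
  rw [Finset.card_erase_of_mem levelOneEdge₁_mem, card_latticeLayer]; rfl

/-- **Row sums of the closed–closed count within the wall-connected patterns are `< 4^{2n}`**: the
all-closed configuration leads out of them. [folklore] -/
theorem sum_ccCount_wallConn_lt (Q : ColPattern n) :
    ∑ Q' ∈ Finset.univ.filter (fun Q' : ColPattern n => WallConn Q'), ccCount n Q Q' < 2 ^ (2 * n) * 2 ^ (2 * n) := by
  classical
  set PS₀ := ((latticeLayer n 0).erase levelOneEdge₀).powerset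
  set PS₁ := ((latticeLayer n 1).erase levelOneEdge₁).powerset
  have hswap : ∑ Q' ∈ Finset.univ.filter (fun Q' : ColPattern n => WallConn Q'), ccCount n Q Q' =
      ∑ V₀ ∈ PS₀, ∑ V₁ ∈ PS₁, if WallConn (twoStep Q V₀ V₁) then 1 else 0 := by
    unfold ccCount
    rw [Finset.sum_comm]
    refine Finset.sum_congr rfl fun V₀ _ => ?_
    rw [Finset.sum_comm]
    refine Finset.sum_congr rfl fun V₁ _ => ?_
    simp only [Finset.sum_ite_eq, Finset.mem_filter, Finset.mem_univ, true_and]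
  rw [hswap]
  have hle : ∀ V₀ ∈ PS₀, (∑ V₁ ∈ PS₁, if WallConn (twoStep Q V₀ V₁) then 1 else 0) ≤ PS₁.card := fun V₀ _ =>
    (Finset.sum_le_card_nsmul _ _ 1 fun V₁ _ => by split_ifs <;> simp).trans (by simp)
  have h0 : (∑ V₁ ∈ PS₁, if WallConn (twoStep Q ∅ V₁) then 1 else 0) + 1 ≤ PS₁.card := by
    have hmem : (∅ : Finset (Sym2 (Site 2))) ∈ PS₁ := Finset.empty_mem_powerset _
    rw [← Finset.add_sum_erase _ _ hmem, if_neg (not_wallConn_twoStep_empty Q), zero_add]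
    calc (∑ V₁ ∈ PS₁.erase ∅, if WallConn (twoStep Q ∅ V₁) then 1 else 0) + 1
        ≤ (PS₁.erase ∅).card + 1 := by
          gcongr
          exact (Finset.sum_le_card_nsmul _ _ 1 fun V₁ _ => by split_ifs <;> simp).trans (by simp)
      _ = PS₁.card := by rw [Finset.card_erase_of_mem hmem]; exact Nat.sub_add_cancel (Finset.card_pos.2 ⟨∅, hmem⟩)
  have hmem₀ : (∅ : Finset (Sym2 (Site 2))) ∈ PS₀ := Finset.empty_mem_powerset _
  have hcard₀ : PS₀.card = 2 ^ (2 * n) := by rw [Finset.card_powerset, card_erase_levelOneEdge₀]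
  have hcard₁ : PS₁.card = 2 ^ (2 * n) := by rw [Finset.card_powerset, card_erase_levelOneEdge₁]
  rw [← Finset.add_sum_erase _ _ hmem₀, show 2 ^ (2 * n) * 2 ^ (2 * n) = PS₀.card * PS₁.card by rw [hcard₀, hcard₁]]
  have hrest : (∑ V₀ ∈ PS₀.erase ∅, ∑ V₁ ∈ PS₁, if WallConn (twoStep Q V₀ V₁) then 1 else 0) ≤ (PS₀.erase ∅).card * PS₁.card := by
    have := Finset.sum_le_card_nsmul _ _ _ fun V₀ hV₀ => hle V₀ (Finset.mem_of_mem_erase (s := PS₀) (a := ∅) hV₀)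
    rwa [smul_eq_mul] at this
  rw [Finset.card_erase_of_mem hmem₀] at hrest
  have hpos : 1 ≤ PS₀.card := Finset.card_pos.2 ⟨∅, hmem₀⟩
  calc (∑ V₁ ∈ PS₁, if WallConn (twoStep Q ∅ V₁) then 1 else 0) +
        ∑ V₀ ∈ PS₀.erase ∅, ∑ V₁ ∈ PS₁, (if WallConn (twoStep Q V₀ V₁) then 1 else 0)
      < PS₁.card + (PS₀.card - 1) * PS₁.card := by omega
    _ = PS₀.card * PS₁.card := by
        conv_rhs => rw [← Nat.sub_add_cancel hpos]
        ring

/-- **A strictly substochastic count matrix has no eigenvalue at the bound.** If `A` has natural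
entries with row sums `< K` on an index set, then `det (A - K) ≠ 0` over `ℂ`. [folklore] -/
theorem det_natMatrix_sub_ne_zero {ι : Type*} [Fintype ι] [DecidableEq ι] (A : Matrix ι ι ℕ) (K : ℕ)
    (hA : ∀ i, ∑ j, A i j < K) :
    ((A.map (fun x : ℕ => (x : ℂ))) - (K : ℂ) • (1 : Matrix ι ι ℂ)).det ≠ 0 := by
  intro hdet
  obtain ⟨v, hv0, hv⟩ := Matrix.exists_mulVec_eq_zero_iff.2 hdet
  -- a coordinate of maximal modulus
  have hne : (Finset.univ : Finset ι).Nonempty := by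
    by_contra h
    rw [Finset.not_nonempty_iff_eq_empty, Finset.univ_eq_empty_iff] at h
    exact hv0 (funext fun i => (h.false i).elim)
  obtain ⟨i, -, hi⟩ := Finset.exists_max_image Finset.univ (fun j => ‖v j‖) hne
  have hrow : ∑ j, (A i j : ℂ) * v j = (K : ℂ) * v i := by
    have := congrFun hv i
    rw [Matrix.sub_mulVec, Matrix.smul_mulVec, Matrix.one_mulVec, Pi.sub_apply, Pi.smul_apply, Pi.zero_apply,
      sub_eq_zero, smul_eq_mul] at this
    simpa [Matrix.mulVec, dotProduct, Matrix.map_apply] using this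
  have hbound : (K : ℝ) * ‖v i‖ ≤ (∑ j, (A i j : ℝ)) * ‖v i‖ := by
    calc (K : ℝ) * ‖v i‖ = ‖(K : ℂ) * v i‖ := by rw [norm_mul, Complex.norm_natCast]
      _ = ‖∑ j, (A i j : ℂ) * v j‖ := by rw [hrow]
      _ ≤ ∑ j, ‖(A i j : ℂ) * v j‖ := norm_sum_le _ _
      _ = ∑ j, (A i j : ℝ) * ‖v j‖ := Finset.sum_congr rfl fun j _ => by rw [norm_mul, Complex.norm_natCast]
      _ ≤ ∑ j, (A i j : ℝ) * ‖v i‖ := Finset.sum_le_sum fun j _ => by gcongr; exact hi j (Finset.mem_univ _)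
      _ = (∑ j, (A i j : ℝ)) * ‖v i‖ := by rw [Finset.sum_mul]
  have hlt : (∑ j, (A i j : ℝ)) < K := by exact_mod_cast hA i
  have hvi : ‖v i‖ = 0 := by
    nlinarith [norm_nonneg (v i)]
  apply hv0
  funext j
  have := hi j (Finset.mem_univ _)
  rw [hvi] at this
  exact norm_le_zero_iff.1 this

variable {P : ColPattern n → MvPolynomial ℕ ℂ} {a : ℤ}

/-- Edge weights with constant weight `-1` on a layer of even size are `1`. [folklore] -/
theorem edgeWt_neg_one {L V : Finset (Sym2 (Site 2))} (hV : V ⊆ L) (hL : Even L.card) :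
    edgeWt (fun _ => (-1 : ℂ)) (fun _ => -1) L V = 1 := by
  unfold edgeWt
  rw [Finset.prod_const, Finset.prod_const, ← pow_add, Finset.card_sdiff_of_subset hV, Nat.add_sub_cancel' (Finset.card_le_card hV)]
  exact hL.neg_one_pow

/-- **At the percolation point the closed–closed kernel counts configurations.** [cite: IkhlefPonsaing2012, §3.4] -/
theorem eval_gsCcKernel (hq : q ^ 2 + q + 1 = 0) {w₀ : ℂ} (hw : w₀ ^ 2 = -q) (Q Q' : ColPattern n) :
    eval (ipEvalPt w₀) (gsCcKernel q n Q Q') = (ccCount n Q Q' : ℂ) := by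
  unfold gsCcKernel
  rw [map_ccKernel]
  have h₀ : ∀ e ∈ (latticeLayer n 0).erase levelOneEdge₀,
      (⇑(eval (ipEvalPt w₀)) ∘ ipNumPoly q 0) e = (fun _ => (-1 : ℂ)) e ∧ (⇑(eval (ipEvalPt w₀)) ∘ ipClosedPoly q 0) e = (fun _ => (-1 : ℂ)) e := by
    intro e he
    have hk : (edgeTopLevel e).toNat ≠ 0 := by have := two_le_edgeTopLevel_of_mem_erase₀ he; omega
    simp only [Function.comp, ipClosedPoly, map_sub, eval_ipNumPoly hq hw 0 hk, eval_ipDenPoly hq hw 0 hk]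
    norm_num
  have h₁ : ∀ e ∈ (latticeLayer n 1).erase levelOneEdge₁,
      (⇑(eval (ipEvalPt w₀)) ∘ ipNumPoly q 1) e = (fun _ => (-1 : ℂ)) e ∧ (⇑(eval (ipEvalPt w₀)) ∘ ipClosedPoly q 1) e = (fun _ => (-1 : ℂ)) e := by
    intro e he
    have hk : (edgeTopLevel e).toNat ≠ 0 := by have := two_le_edgeTopLevel_of_mem_erase₁ he; omega
    simp only [Function.comp, ipClosedPoly, map_sub, eval_ipNumPoly hq hw 1 hk, eval_ipDenPoly hq hw 1 hk]
    norm_num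
  rw [ccKernel_congr h₀ h₁, ccKernel, ccCount, Nat.cast_sum]
  refine Finset.sum_congr rfl fun V₀ hV₀ => ?_
  rw [Nat.cast_sum]
  refine Finset.sum_congr rfl fun V₁ hV₁ => ?_
  rw [Finset.mem_powerset] at hV₀ hV₁
  rw [edgeWt_neg_one hV₀ (by rw [card_erase_levelOneEdge₀]; exact even_two_mul n),
    edgeWt_neg_one hV₁ (by rw [card_erase_levelOneEdge₁]; exact even_two_mul n)]
  split_ifs <;> simp

/-- At the percolation point the reduced denominator is `4^{2n}`. [cite: IkhlefPonsaing2012, §3.4] -/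
theorem eval_gsCcDelta (hq : q ^ 2 + q + 1 = 0) {w₀ : ℂ} (hw : w₀ ^ 2 = -q) :
    eval (ipEvalPt w₀) (gsCcDelta q n) = ((2 ^ (2 * n) * 2 ^ (2 * n) : ℕ) : ℂ) := by
  unfold gsCcDelta
  rw [map_mul, map_prod, map_prod,
    Finset.prod_congr rfl fun e he => eval_ipDenPoly hq hw 0 (by have := two_le_edgeTopLevel_of_mem_erase₀ (n := n) he; omega),
    Finset.prod_congr rfl fun e he => eval_ipDenPoly hq hw 1 (by have := two_le_edgeTopLevel_of_mem_erase₁ (n := n) he; omega),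
    Finset.prod_const, Finset.prod_const, card_erase_levelOneEdge₀, card_erase_levelOneEdge₁]
  push_cast
  rw [show (-2 : ℂ) ^ (2 * n) = 2 ^ (2 * n) from by rw [pow_mul, pow_mul]; norm_num]

/-- The closed–closed kernel does not lead from wall-disconnected to wall-connected patterns.
[cite: IkhlefPonsaing2012, §3.1] -/
theorem gsCcKernel_eq_zero_of_not_wallConn {Q Q' : ColPattern n} (hQ : IsValid 0 Q) (hD : ¬ WallConn Q)
    (hQ' : WallConn Q') : gsCcKernel q n Q Q' = 0 := by
  unfold gsCcKernel ccKernel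
  refine Finset.sum_eq_zero fun V₀ hV₀ => Finset.sum_eq_zero fun V₁ hV₁ => ?_
  rw [Finset.mem_powerset] at hV₀ hV₁
  rw [if_neg]
  intro h
  exact not_wallConn_twoStep hQ hD (edgeFn_zero_bottom hV₀) (edgeFn_one_bottom hV₁) (h ▸ hQ')

namespace IsGroundState

/-- **Vanishing at `z_1 = 0` on wall-connected patterns**: `P_Q(z_1 := 0) = 0` whenever some
site of `Q` other than the bottom one touches the wall. (At `z_1 = 0` the transfer matrix only
keeps the level-`1` edges closed, so it maps wall-disconnected patterns to wall-disconnected ones;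
on the wall-connected block `t^{cc} - 1` is invertible, as seen at the percolation point where
`t^{cc}` is strictly substochastic.) [cite: IkhlefPonsaing2012, §3.1, §4.1] -/
theorem substHom_one_zero_eq_zero (hq : q ^ 2 + q + 1 = 0) (h : IsGroundState n q P a) {Q : ColPattern n}
    (hQ : WallConn Q) : substHom 1 0 (P Q) = 0 := by
  classical
  -- the wall-connected block
  set S := {Q : ColPattern n // WallConn Q}
  set N : Matrix S S (MvPolynomial ℕ ℂ) := Matrix.of fun Q Q' => gsCcKernel q n Q.1 Q'.1 with hN
  set M : Matrix S S (MvPolynomial ℕ ℂ) := N - gsCcDelta q n • (1 : Matrix S S (MvPolynomial ℕ ℂ)) with hM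
  set v : S → MvPolynomial ℕ ℂ := fun Q => substHom 1 0 (P Q.1) with hv
  -- `v M = 0`
  have hvM : Matrix.vecMul v M = 0 := by
    funext Q'
    rw [hM, Matrix.vecMul_sub, Matrix.vecMul_smul, Matrix.vecMul_one, Pi.sub_apply, Pi.smul_apply, Pi.zero_apply,
      sub_eq_zero, smul_eq_mul]
    simp only [Matrix.vecMul, dotProduct, hN, Matrix.of_apply, hv]
    have hfp := h.sum_substHom_mul_gsCcKernel hq Q'.1
    rw [← Finset.sum_filter_add_sum_filter_not Finset.univ (fun Q : ColPattern n => WallConn Q)] at hfp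
    have hzero : ∑ Q ∈ Finset.univ.filter (fun Q : ColPattern n => ¬ WallConn Q), substHom 1 0 (P Q) * gsCcKernel q n Q Q'.1 = 0 := by
      refine Finset.sum_eq_zero fun Q hQm => ?_
      rw [Finset.mem_filter] at hQm
      by_cases hPQ : P Q = 0
      · rw [hPQ, map_zero, zero_mul]
      · obtain ⟨hval, -, -⟩ := h.supp hq Q (fun h0 => hPQ (toRF_injective (by rw [h0, map_zero])))
        rw [gsCcKernel_eq_zero_of_not_wallConn hval hQm.2 Q'.2, mul_zero]
    rw [hzero, add_zero] at hfp
    exact (Finset.sum_subtype (Finset.univ.filter (fun Q : ColPattern n => WallConn Q)) (fun Q => by simp)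
      (fun Q : ColPattern n => substHom 1 0 (P Q) * gsCcKernel q n Q Q'.1)).symm.trans hfp
  -- `det M ≠ 0`, seen at the percolation point
  have hdet : M.det ≠ 0 := by
    obtain ⟨w₀, hw⟩ := IsAlgClosed.exists_pow_nat_eq (-q) (n := 2) two_pos
    intro h0
    have hmap := RingHom.map_det (MvPolynomial.eval (ipEvalPt w₀)) M
    rw [h0, map_zero] at hmap
    refine det_natMatrix_sub_ne_zero (Matrix.of fun Q Q' : S => ccCount n Q.1 Q'.1) (2 ^ (2 * n) * 2 ^ (2 * n))
      (fun Q => ?_) ?_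
    · simp only [Matrix.of_apply]
      rw [← Finset.sum_subtype (Finset.univ.filter (fun Q : ColPattern n => WallConn Q)) (fun Q => by simp)
        (fun Q' : ColPattern n => ccCount n Q.1 Q')]
      exact sum_ccCount_wallConn_lt Q.1
    · rw [hmap]
      congr 1
      ext Q Q'
      simp only [RingHom.mapMatrix_apply, Matrix.map_apply, hM, hN, Matrix.sub_apply, Matrix.of_apply, map_sub,
        Matrix.smul_apply, Matrix.one_apply, smul_eq_mul, mul_ite, mul_one, mul_zero]
      rw [eval_gsCcKernel hq hw]
      congr 1
      split_ifs
      · rw [eval_gsCcDelta hq hw]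
      · exact map_zero (MvPolynomial.eval (ipEvalPt w₀))
  have hv0 : v = 0 := Matrix.eq_zero_of_vecMul_eq_zero hdet hvM
  have := congrFun hv0 ⟨Q, hQ⟩
  simpa [hv] using this

/-- **The `vanish` clause of `GroundStateBounds`**: on a junction pair (site `2n` joined to the wall
through `Q ∪ Q'`), `P_Q(z_1:=0) · P_{Q'}(z_1:=0) = 0` (width `n ≥ 1`). [cite: IkhlefPonsaing2012, §4.1] -/
theorem vanish (hq : q ^ 2 + q + 1 = 0) (h : IsGroundState n q P a) (hn : n ≠ 0) (Q Q' : ColPattern n)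
    (hJ : ipJunction n (Fin.last n) Q Q' = true) : substHom 1 0 (P Q) * substHom 1 0 (P Q') = 0 := by
  by_cases hPQ : P Q = 0
  · rw [hPQ, map_zero, zero_mul]
  by_cases hPQ' : P Q' = 0
  · rw [hPQ', map_zero, mul_zero]
  obtain ⟨hv, -, -⟩ := h.supp hq Q (fun h0 => hPQ (toRF_injective (by rw [h0, map_zero])))
  obtain ⟨hv', -, -⟩ := h.supp hq Q' (fun h0 => hPQ' (toRF_injective (by rw [h0, map_zero])))
  rcases wallConn_or_of_ipJunction hn hv hv' hJ with hW | hW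
  · rw [h.substHom_one_zero_eq_zero hq hW, zero_mul]
  · rw [h.substHom_one_zero_eq_zero hq hW, mul_zero]

end IsGroundState

end WallVanishing




end Literature.Probability.Percolation
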